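import Summits.HubbardSuperconductivity.HubbardSuperconductivity.Theorems.TwSourcedCondensation.Negative.UniformThreshold

/-!
# Crux `TwSourcedCondensation` (item `stmt-HubbardSuperconductivity-1697`): the lead's free COOPER-LOG stub —
the window reduces to its corner and `∃ L₀(β,μ)` is load-bearing (TARGETS of the standing disprover, gen 3)

`--supports` file; no definition introduced. Stub (F) `stub_freeLinearCooperLog` of the line
`entropy-staircase-linear-regime` (skeleton `f819e3d0`): `c₀h² log β - C₀h² ≤ p̃₀(β,h) - p̃₀(β,0)` on
`|h| ≤ 1/β`, `∃ L₀` after `β, μ`. It SURVIVES as stated. Proved here: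

* `stubF_of_corner` (PROVER AID) — (F) on the whole window FOLLOWS from the single corner inequality
  `(c₀ log β - C₀)/β² ≤ p̃₀(β,1/β) - p̃₀(β,0)` (eventually in `L`): the free gain per `s²` is non-increasing
  in `|s|` (`free_logGain_div_sq_antitone`, per mode `bdgModeGain_div_sq_antitone`) because the BdG mode
  function `G(v) = log((1+cosh √v)/2)` is CONCAVE on `[0,∞)` (`concaveOn_bdgG`: `G' = tanh(√v/2)/(2√v)` is
  non-increasing since `tanh` is concave on `[0,∞)`, `concaveOn_tanh_Ici`, `tanh_div_le_tanh_div`);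
  `free_logGain_even` — the free gain is even in the source;
* `stub_freeLinearCooperLog_false_uniformL0` — (F) with `L₀` chosen BEFORE `β, μ` is FALSE (generic gapped
  torus, `free_gain_le_of_levelGap` of `UniformThreshold`: free response `≤ 32h²/γ` for every `β`, against the
  floor `(c₀ log β - C₀)/β²` at `h = 1/β`). `L₀(β,μ)` must grow with `β`.
Tree: `log_partitionFn_dWaveSourceTorus_zero_sub`, `Real.hasDerivAt_sqrt`, `Real.hasDerivAt_cosh/sinh`,
`AntitoneOn.concaveOn_of_deriv`, `ConvexOn.secant_mono`, `one_add_cosh`.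
-/

noncomputable section

namespace Summit.HubbardSuperconductivity.HubbardSuperconductivity.Theorems.TwSourcedCondensation.Negative

open Matrix Finset Literature.MathematicalPhysics.QuantumLattice Literature.Probability.LatticeModels
open Summit.HubbardSuperconductivity.HubbardSuperconductivity.Theorems
open scoped Matrix.Norms.L2Operator ComplexOrder

/-! ### (F): the window reduces to its CORNER `|h| = 1/β` (prover aid)
The BdG mode gain is CONCAVE in `s²`: `G(v) = log((1+cosh √v)/2)` has `G' = tanh(√v/2)/(2√v)`,
non-increasing because `tanh` is concave on `[0,∞)`. Hence the free gain per `s²` is non-increasing in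
`|s|` and stub (F) on all of `|h| ≤ 1/β` follows from the single inequality at `|h| = 1/β`
(`stubF_of_corner`). -/

/-! ### `tanh` is concave on `[0, ∞)`, so `tanh w / w` is non-increasing -/

/-- `tanh' = 1/cosh²`. [folklore] -/
theorem hasDerivAt_real_tanh (x : ℝ) : HasDerivAt Real.tanh (1 / Real.cosh x ^ 2) x := by
  have hc : Real.cosh x ≠ 0 := (Real.cosh_pos x).ne'
  have h := (Real.hasDerivAt_sinh x).div (Real.hasDerivAt_cosh x) hc
  have heq : (Real.sinh / Real.cosh : ℝ → ℝ) = Real.tanh := by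
    funext y; simp [Real.tanh_eq_sinh_div_cosh]
  rw [heq] at h
  have h1 : Real.cosh x * Real.cosh x - Real.sinh x * Real.sinh x = 1 := by
    have := Real.cosh_sq_sub_sinh_sq x
    nlinarith
  refine h.congr_deriv ?_
  rw [h1]

/-- `tanh` is concave on `[0,∞)` (its derivative `1/cosh²` is non-increasing there). [folklore] -/
theorem concaveOn_tanh_Ici : ConcaveOn ℝ (Set.Ici (0 : ℝ)) Real.tanh := by
  refine AntitoneOn.concaveOn_of_deriv (convex_Ici 0)
    Literature.Barriers.HubbardSuperconductivity.continuous_real_tanh.continuousOn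
    (fun x _ => (hasDerivAt_real_tanh x).differentiableAt.differentiableWithinAt) ?_
  rw [interior_Ici]
  intro x hx y hy hxy
  rw [(hasDerivAt_real_tanh x).deriv, (hasDerivAt_real_tanh y).deriv]
  have hx0 : 0 < x := hx
  have hy0 : 0 < y := hy
  apply one_div_le_one_div_of_le (pow_pos (Real.cosh_pos x) 2)
  exact pow_le_pow_left₀ (Real.cosh_pos x).le
    (Real.cosh_le_cosh.2 (by rw [abs_of_pos hx0, abs_of_pos hy0]; exact hxy)) 2

/-- `tanh w / w` is non-increasing on `(0,∞)`. [folklore] -/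
theorem tanh_div_le_tanh_div {a b : ℝ} (ha : 0 < a) (hab : a ≤ b) :
    Real.tanh b / b ≤ Real.tanh a / a := by
  rcases hab.eq_or_lt with rfl | hlt
  · exact le_rfl
  have hb : 0 < b := ha.trans hlt
  have hconv : ConvexOn ℝ (Set.Ici (0 : ℝ)) (-Real.tanh) := concaveOn_tanh_Ici.neg
  have key := hconv.secant_mono (a := 0) (x := a) (y := b) Set.self_mem_Ici ha.le hb.le ha.ne' hb.ne' hab
  simp only [Pi.neg_apply, Real.tanh_zero, neg_zero, sub_zero] at key
  rw [neg_div, neg_div] at key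
  linarith

/-! ### The BdG mode function `G(v) = log((1 + cosh √v)/2)` is concave on `[0,∞)` -/

/-- Half-angle: `sinh y/(1 + cosh y) = tanh(y/2)`. [folklore] -/
theorem sinh_div_one_add_cosh (y : ℝ) : Real.sinh y / (1 + Real.cosh y) = Real.tanh (y / 2) := by
  have h1 : Real.sinh y = 2 * Real.sinh (y / 2) * Real.cosh (y / 2) := by
    rw [← Real.sinh_two_mul]; ring_nf
  have h2 : 1 + Real.cosh y = 2 * Real.cosh (y / 2) ^ 2 := one_add_cosh y
  have hc : Real.cosh (y / 2) ≠ 0 := (Real.cosh_pos _).ne'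
  rw [h1, h2, Real.tanh_eq_sinh_div_cosh]
  field_simp

/-- Derivative of `G(v) = log((1+cosh √v)/2)` at `v > 0`: `G'(v) = tanh(√v/2)/(2√v)`. [folklore] -/
theorem hasDerivAt_bdgG {v : ℝ} (hv : 0 < v) :
    HasDerivAt (fun v => Real.log ((1 + Real.cosh (Real.sqrt v)) / 2))
      (Real.tanh (Real.sqrt v / 2) / (2 * Real.sqrt v)) v := by
  have hs : HasDerivAt Real.sqrt (1 / (2 * Real.sqrt v)) v := Real.hasDerivAt_sqrt hv.ne'
  have hcosh : HasDerivAt (fun v => Real.cosh (Real.sqrt v))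
      (Real.sinh (Real.sqrt v) * (1 / (2 * Real.sqrt v))) v := (Real.hasDerivAt_cosh _).comp v hs
  have hin : HasDerivAt (fun v => (1 + Real.cosh (Real.sqrt v)) / 2)
      (Real.sinh (Real.sqrt v) * (1 / (2 * Real.sqrt v)) / 2) v := (hcosh.const_add 1).div_const 2
  have hpos : 0 < (1 + Real.cosh (Real.sqrt v)) / 2 := by
    have := Real.one_le_cosh (Real.sqrt v); positivity
  have hlog := hin.log hpos.ne'
  convert hlog using 1
  have hsv : 0 < Real.sqrt v := Real.sqrt_pos.2 hv
  have h1c : 0 < 1 + Real.cosh (Real.sqrt v) := by linarith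
  rw [← sinh_div_one_add_cosh]
  field_simp

/-- Continuity of `G`. [folklore] -/
theorem continuous_bdgG : Continuous (fun v : ℝ => Real.log ((1 + Real.cosh (Real.sqrt v)) / 2)) := by
  refine Continuous.log (by fun_prop) fun v => ?_
  have := Real.one_le_cosh (Real.sqrt v)
  positivity

/-- `G'` is non-increasing on `(0,∞)`. [folklore] -/
theorem bdgG_deriv_antitone {v v' : ℝ} (hv : 0 < v) (hvv' : v ≤ v') :
    Real.tanh (Real.sqrt v' / 2) / (2 * Real.sqrt v') ≤ Real.tanh (Real.sqrt v / 2) / (2 * Real.sqrt v) := by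
  have hsv : 0 < Real.sqrt v := Real.sqrt_pos.2 hv
  have hsv' : 0 < Real.sqrt v' := Real.sqrt_pos.2 (hv.trans_le hvv')
  have hle : Real.sqrt v / 2 ≤ Real.sqrt v' / 2 := by
    have := Real.sqrt_le_sqrt hvv'; linarith
  have key := tanh_div_le_tanh_div (by positivity) hle
  have e : ∀ w : ℝ, 0 < w → Real.tanh (w / 2) / (2 * w) = (Real.tanh (w / 2) / (w / 2)) / 4 := by
    intro w hw; field_simp; ring
  rw [e _ hsv, e _ hsv']
  linarith

/-- **`G(v) = log((1 + cosh √v)/2)` is concave on `[0,∞)`.** [folklore] -/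
theorem concaveOn_bdgG : ConcaveOn ℝ (Set.Ici (0 : ℝ)) (fun v => Real.log ((1 + Real.cosh (Real.sqrt v)) / 2)) := by
  refine AntitoneOn.concaveOn_of_deriv (convex_Ici 0) continuous_bdgG.continuousOn ?_ ?_
  · rw [interior_Ici]
    intro v hv
    exact (hasDerivAt_bdgG (show 0 < v from hv)).differentiableAt.differentiableWithinAt
  · rw [interior_Ici]
    intro v hv v' hv' hvv'
    rw [(hasDerivAt_bdgG (show 0 < v from hv)).deriv, (hasDerivAt_bdgG (show 0 < v' from hv')).deriv]
    exact bdgG_deriv_antitone hv hvv'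

/-- Secant form of the concavity from a base point `v₀ ≥ 0` along a ray `v₀ + c·u`, `c ≥ 0`:
for `0 < u ≤ u'`, `(G(v₀ + cu') - G(v₀))/u' ≤ (G(v₀ + cu) - G(v₀))/u`. [folklore] -/
theorem bdgG_secant_antitone {v₀ c u u' : ℝ} (hv₀ : 0 ≤ v₀) (hc : 0 ≤ c) (hu : 0 < u) (huu' : u ≤ u') :
    (Real.log ((1 + Real.cosh (Real.sqrt (v₀ + c * u'))) / 2) - Real.log ((1 + Real.cosh (Real.sqrt v₀)) / 2)) / u' ≤
      (Real.log ((1 + Real.cosh (Real.sqrt (v₀ + c * u))) / 2) - Real.log ((1 + Real.cosh (Real.sqrt v₀)) / 2)) / u := by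
  set G : ℝ → ℝ := fun v => Real.log ((1 + Real.cosh (Real.sqrt v)) / 2) with hG
  have hu' : 0 < u' := hu.trans_le huu'
  rcases hc.eq_or_lt with hc0 | hcpos
  · rw [← hc0]; simp
  have hconv : ConvexOn ℝ (Set.Ici (0 : ℝ)) (-G) := concaveOn_bdgG.neg
  have hx : v₀ + c * u ∈ Set.Ici (0 : ℝ) := by change 0 ≤ v₀ + c * u; positivity
  have hy : v₀ + c * u' ∈ Set.Ici (0 : ℝ) := by change 0 ≤ v₀ + c * u'; positivity
  have hxa : v₀ + c * u ≠ v₀ := by intro h; nlinarith [mul_pos hcpos hu]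
  have hya : v₀ + c * u' ≠ v₀ := by intro h; nlinarith [mul_pos hcpos hu']
  have hxy : v₀ + c * u ≤ v₀ + c * u' := by nlinarith
  have key := hconv.secant_mono (a := v₀) hv₀ hx hy hxa hya hxy
  simp only [Pi.neg_apply] at key
  rw [show v₀ + c * u - v₀ = c * u by ring, show v₀ + c * u' - v₀ = c * u' by ring] at key
  -- `key : (-G x + G v₀)/(c u) ≤ (-G y + G v₀)/(c u')`
  change (G (v₀ + c * u') - G v₀) / u' ≤ (G (v₀ + c * u) - G v₀) / u
  have e1 : (-G (v₀ + c * u) - -G v₀) / (c * u) = -((G (v₀ + c * u) - G v₀) / u) / c := by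
    field_simp; ring
  have e2 : (-G (v₀ + c * u') - -G v₀) / (c * u') = -((G (v₀ + c * u') - G v₀) / u') / c := by
    field_simp; ring
  rw [e1, e2, div_le_div_iff_of_pos_right hcpos, neg_le_neg_iff] at key
  exact key

/-! ### The free BdG gain per `s²` is non-increasing in `|s|` -/

/-- `β√X = √(β²X)` bookkeeping for the mode function. [folklore] -/
theorem log_cosh_mode_eq {β : ℝ} (hβ : 0 ≤ β) (X : ℝ) :
    Real.log ((1 + Real.cosh (β * Real.sqrt X)) / 2) =
      Real.log ((1 + Real.cosh (Real.sqrt (β ^ 2 * X))) / 2) := by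
  rw [Real.sqrt_mul (sq_nonneg β), Real.sqrt_sq hβ]

/-- **Per-mode: the BdG gain per `s²` is non-increasing in `|s|`**: for `0 < s ≤ s'`,
`m(s')/s'² ≤ m(s)/s²`, `m(s) = log((1+cosh βE(s))/2) - log((1+cosh βξ)/2)`, `E(s)² = ξ² + (2√2 s ĝ)²`. [folklore] -/
theorem bdgModeGain_div_sq_antitone {β : ℝ} (hβ : 0 < β) (ξ g : ℝ) {s s' : ℝ} (hs : 0 < s) (hss' : s ≤ s') :
    (Real.log ((1 + Real.cosh (β * Real.sqrt (ξ ^ 2 + (2 * Real.sqrt 2 * s' * g) ^ 2))) / 2) -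
        Real.log ((1 + Real.cosh (β * ξ)) / 2)) / s' ^ 2 ≤
      (Real.log ((1 + Real.cosh (β * Real.sqrt (ξ ^ 2 + (2 * Real.sqrt 2 * s * g) ^ 2))) / 2) -
        Real.log ((1 + Real.cosh (β * ξ)) / 2)) / s ^ 2 := by
  have h2 : Real.sqrt 2 ^ 2 = 2 := Real.sq_sqrt zero_le_two
  have hX : ∀ t : ℝ, ξ ^ 2 + (2 * Real.sqrt 2 * t * g) ^ 2 = ξ ^ 2 + 8 * g ^ 2 * t ^ 2 := by
    intro t; rw [mul_pow, mul_pow, mul_pow, h2]; ring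
  have hξ : Real.log ((1 + Real.cosh (β * ξ)) / 2) = Real.log ((1 + Real.cosh (Real.sqrt (β ^ 2 * ξ ^ 2))) / 2) := by
    rw [show β ^ 2 * ξ ^ 2 = (β * ξ) ^ 2 by ring, Real.sqrt_sq_eq_abs]
    rcases abs_choice (β * ξ) with h | h
    · rw [h]
    · rw [h, Real.cosh_neg]
  rw [hX s, hX s', log_cosh_mode_eq hβ.le, log_cosh_mode_eq hβ.le, hξ,
    show β ^ 2 * (ξ ^ 2 + 8 * g ^ 2 * s' ^ 2) = β ^ 2 * ξ ^ 2 + (8 * β ^ 2 * g ^ 2) * s' ^ 2 by ring,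
    show β ^ 2 * (ξ ^ 2 + 8 * g ^ 2 * s ^ 2) = β ^ 2 * ξ ^ 2 + (8 * β ^ 2 * g ^ 2) * s ^ 2 by ring]
  exact bdgG_secant_antitone (by positivity) (by positivity) (by positivity)
    (pow_le_pow_left₀ hs.le hss' 2)

section CornerL

variable {L : ℕ} [NeZero L]

/-- **The free sourced gain per `s²` is non-increasing in `|s|`** (`L ≥ 3`, `β > 0`, numerator form):
for `0 < s ≤ s'`, `[log Z(s') - log Z(0)]/s'² ≤ [log Z(s) - log Z(0)]/s²`. [folklore] -/
theorem free_logGain_div_sq_antitone (hL : 3 ≤ L) {β : ℝ} (hβ : 0 < β) (μ : ℝ) {s s' : ℝ}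
    (hs : 0 < s) (hss' : s ≤ s') :
    (Real.log (partitionFn β (dWaveSourceTorus L 0 μ s')).re -
        Real.log (partitionFn β (dWaveSourceTorus L 0 μ 0)).re) / s' ^ 2 ≤
      (Real.log (partitionFn β (dWaveSourceTorus L 0 μ s)).re -
        Real.log (partitionFn β (dWaveSourceTorus L 0 μ 0)).re) / s ^ 2 := by
  rw [log_partitionFn_dWaveSourceTorus_zero_sub hL β μ s', log_partitionFn_dWaveSourceTorus_zero_sub hL β μ s,
    Finset.sum_div, Finset.sum_div]
  exact Finset.sum_le_sum fun k _ => bdgModeGain_div_sq_antitone hβ (torusBand L k - μ) (dWaveGap k) hs hss'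

/-- The free gain is EVEN in the source (it depends on `s²` only). [folklore] -/
theorem free_logGain_even (hL : 3 ≤ L) (β μ s : ℝ) :
    Real.log (partitionFn β (dWaveSourceTorus L 0 μ (-s))).re -
        Real.log (partitionFn β (dWaveSourceTorus L 0 μ 0)).re =
      Real.log (partitionFn β (dWaveSourceTorus L 0 μ s)).re -
        Real.log (partitionFn β (dWaveSourceTorus L 0 μ 0)).re := by
  rw [log_partitionFn_dWaveSourceTorus_zero_sub hL β μ (-s), log_partitionFn_dWaveSourceTorus_zero_sub hL β μ s]
  refine Finset.sum_congr rfl fun k _ => ?_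
  rw [show (2 * Real.sqrt 2 * -s * dWaveGap k) ^ 2 = (2 * Real.sqrt 2 * s * dWaveGap k) ^ 2 by ring]

/-- **Stub (F) on the whole window follows from its CORNER `|h| = 1/β`.** If for every compact
`[μ₁,μ₂] ⊂ (-4,0)` there are `c₀, C₀ > 0` with `(c₀ log β - C₀)/β² ≤ p̃₀(β,1/β) - p̃₀(β,0)` eventually in `L`
(`β ≥ 1`, `μ ∈ [μ₁,μ₂]`), then the registered stub (F) holds (same constants, `L₀ := max(L₀,3)`):
`c₀h² log β - C₀h² ≤ p̃₀(β,h) - p̃₀(β,0)` for all `|h| ≤ 1/β`. [folklore] -/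
theorem stubF_of_corner
    (Hc : ∀ μ₁ μ₂ : ℝ, -4 < μ₁ → μ₁ ≤ μ₂ → μ₂ < 0 → ∃ c₀ C₀ : ℝ, 0 < c₀ ∧ 0 < C₀ ∧ ∀ β : ℝ, 1 ≤ β →
      ∀ μ ∈ Set.Icc μ₁ μ₂, ∃ L₀ : ℕ, ∀ (L : ℕ) [NeZero L], L₀ ≤ L →
        (c₀ * Real.log β - C₀) / β ^ 2 ≤
          Real.log (partitionFn β (dWaveSourceTorus L 0 μ (1 / β))).re / (β * (L : ℝ) ^ 2) -
            Real.log (partitionFn β (dWaveSourceTorus L 0 μ 0)).re / (β * (L : ℝ) ^ 2)) :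
    ∀ μ₁ μ₂ : ℝ, -4 < μ₁ → μ₁ ≤ μ₂ → μ₂ < 0 → ∃ c₀ C₀ : ℝ, 0 < c₀ ∧ 0 < C₀ ∧ ∀ β : ℝ, 1 ≤ β →
      ∀ μ ∈ Set.Icc μ₁ μ₂, ∃ L₀ : ℕ, ∀ (L : ℕ) [NeZero L], L₀ ≤ L → ∀ h : ℝ, |h| ≤ 1 / β →
        c₀ * h ^ 2 * Real.log β - C₀ * h ^ 2 ≤
          Real.log (partitionFn β (dWaveSourceTorus L 0 μ h)).re / (β * (L : ℝ) ^ 2) -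
            Real.log (partitionFn β (dWaveSourceTorus L 0 μ 0)).re / (β * (L : ℝ) ^ 2) := by
  intro μ₁ μ₂ h1 h2 h3
  obtain ⟨c₀, C₀, hc₀, hC₀, H⟩ := Hc μ₁ μ₂ h1 h2 h3
  refine ⟨c₀, C₀, hc₀, hC₀, fun β hβ μ hμ => ?_⟩
  obtain ⟨L₀, hL₀⟩ := H β hβ μ hμ
  refine ⟨max L₀ 3, fun L _ hL h hh => ?_⟩
  have hL3 : 3 ≤ L := le_of_max_le_right hL
  have hβpos : 0 < β := by linarith
  have hLpos : (0 : ℝ) < (L : ℝ) ^ 2 := by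
    have : (0 : ℝ) < L := by exact_mod_cast (show 0 < L by omega)
    positivity
  have hden : 0 < β * (L : ℝ) ^ 2 := mul_pos hβpos hLpos
  have corner := hL₀ L (le_of_max_le_left hL)
  -- reduce to `s = |h| > 0`
  rcases eq_or_ne h 0 with rfl | hh0
  · simp
  have hs : 0 < |h| := abs_pos.2 hh0
  -- the gain at `h` equals the gain at `|h|`
  have heven : Real.log (partitionFn β (dWaveSourceTorus L 0 μ h)).re -
      Real.log (partitionFn β (dWaveSourceTorus L 0 μ 0)).re =
      Real.log (partitionFn β (dWaveSourceTorus L 0 μ |h|)).re -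
        Real.log (partitionFn β (dWaveSourceTorus L 0 μ 0)).re := by
    rcases abs_choice h with habs | habs
    · rw [habs]
    · rw [habs, free_logGain_even hL3]
  have mono := free_logGain_div_sq_antitone hL3 hβpos μ hs hh
  -- corner in numerator form: `(c₀ log β - C₀)/β² · βL² ≤ log Z(1/β) - log Z(0)`
  rw [← sub_div, le_div_iff₀ hden] at corner ⊢
  rw [heven]
  set Gs := Real.log (partitionFn β (dWaveSourceTorus L 0 μ |h|)).re -
    Real.log (partitionFn β (dWaveSourceTorus L 0 μ 0)).re with hGs
  set Gc := Real.log (partitionFn β (dWaveSourceTorus L 0 μ (1 / β))).re -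
    Real.log (partitionFn β (dWaveSourceTorus L 0 μ 0)).re with hGc
  -- `Gc/(1/β)² ≤ Gs/|h|²`, i.e. `Gc β² ≤ Gs/h²`
  have hs2 : 0 < |h| ^ 2 := by positivity
  have hh2 : |h| ^ 2 = h ^ 2 := sq_abs h
  have m2 : Gc * β ^ 2 * h ^ 2 ≤ Gs := by
    have := mono
    rw [div_le_div_iff₀ (by positivity) hs2] at this
    -- `Gc * |h|^2 ≤ Gs * (1/β)^2`
    have e : Gs * (1 / β) ^ 2 * β ^ 2 = Gs := by field_simp
    have e3 : Gc * |h| ^ 2 * β ^ 2 = Gc * β ^ 2 * h ^ 2 := by rw [hh2]; ring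
    have h4 := mul_le_mul_of_nonneg_right this (sq_nonneg β)
    rw [e3, e] at h4
    exact h4
  have c2 : (c₀ * Real.log β - C₀) * (L : ℝ) ^ 2 ≤ Gc * β := by
    have e : (c₀ * Real.log β - C₀) / β ^ 2 * (β * (L : ℝ) ^ 2) = (c₀ * Real.log β - C₀) * (L : ℝ) ^ 2 / β := by
      field_simp
    rw [e, div_le_iff₀ hβpos] at corner
    exact corner
  -- combine: `(c₀ log β - C₀) h² βL² ≤ Gc β · β h² · ... `
  have h2nn : 0 ≤ h ^ 2 := sq_nonneg h
  calc (c₀ * h ^ 2 * Real.log β - C₀ * h ^ 2) * (β * (L : ℝ) ^ 2)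
      = ((c₀ * Real.log β - C₀) * (L : ℝ) ^ 2) * (β * h ^ 2) := by ring
    _ ≤ (Gc * β) * (β * h ^ 2) := mul_le_mul_of_nonneg_right c2 (by positivity)
    _ = Gc * β ^ 2 * h ^ 2 := by ring
    _ ≤ Gs := m2

end CornerL

/-- **TARGET (F): the `L₀`-uniform free Cooper logarithm is FALSE** (stub (F) with `∃ L₀` before `β, μ`).
On a torus whose free levels avoid `μ` by `γ` the free response is `≤ 32h²/γ` for EVERY `β`, while the
stub's floor at `h = 1/β` is `(c₀ log β - C₀)/β²`. Witness: `[-3,-1]`, `L = max(L₀,3)`, generic `μ`,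
`β = exp((32/γ + C₀)/c₀ + 1)`, `h = 1/β`. MESSAGE: in (F) the threshold `L₀(β,μ)` must grow with `β`. [folklore] -/
theorem stub_freeLinearCooperLog_false_uniformL0 :
    ¬ (∀ μ₁ μ₂ : ℝ, -4 < μ₁ → μ₁ ≤ μ₂ → μ₂ < 0 → ∃ c₀ C₀ : ℝ, ∃ L₀ : ℕ, 0 < c₀ ∧ 0 < C₀ ∧ ∀ β : ℝ, 1 ≤ β →
      ∀ μ ∈ Set.Icc μ₁ μ₂, ∀ (L : ℕ) [NeZero L], L₀ ≤ L → ∀ h : ℝ, |h| ≤ 1 / β →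
        c₀ * h ^ 2 * Real.log β - C₀ * h ^ 2 ≤
          Real.log (partitionFn β (dWaveSourceTorus L 0 μ h)).re / (β * (L : ℝ) ^ 2) -
            Real.log (partitionFn β (dWaveSourceTorus L 0 μ 0)).re / (β * (L : ℝ) ^ 2)) := by
  intro H
  obtain ⟨c₀, C₀, L₀, hc₀, hC₀, H⟩ := H (-3) (-1) (by norm_num) (by norm_num) (by norm_num)
  set L : ℕ := max L₀ 3 with hLdef
  have hL3 : 3 ≤ L := le_max_right _ _
  have hL₀ : L₀ ≤ L := le_max_left _ _
  haveI : NeZero L := ⟨by omega⟩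
  obtain ⟨μ, hμ, γ, hγ, hgap⟩ := exists_mu_off_levels L (show (-3 : ℝ) < -1 by norm_num)
  set β : ℝ := Real.exp ((32 / γ + C₀) / c₀ + 1) with hβ
  have hβpos : 0 < β := Real.exp_pos _
  have hβ1 : 1 ≤ β := Real.one_le_exp (by positivity)
  have key := H β hβ1 μ hμ L hL₀ (1 / β) (by rw [abs_of_pos (one_div_pos.2 hβpos)])
  have hcap := free_gain_le_of_levelGap hL3 hγ hgap hβpos (1 / β)
  rw [hβ, Real.log_exp] at key
  have hh2 : 0 < (1 / β) ^ 2 := by positivity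
  have hc0 : c₀ ≠ 0 := hc₀.ne'
  have e : c₀ * ((32 / γ + C₀) / c₀ + 1) - C₀ = 32 / γ + c₀ := by field_simp; ring
  have : (c₀ * ((32 / γ + C₀) / c₀ + 1) - C₀) * (1 / β) ^ 2 ≤ 32 / γ * (1 / β) ^ 2 := by
    have e2 : 32 * (1 / β) ^ 2 / γ = 32 / γ * (1 / β) ^ 2 := by ring
    nlinarith
  rw [e] at this
  nlinarith [mul_pos hc₀ hh2]

end Summit.HubbardSuperconductivity.HubbardSuperconductivity.Theorems.TwSourcedCondensation.Negative
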